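import Summits.MatrixMultiplication.MatrixMultiplication.Theorems.AbelianSTPPCensusShapeCertVQTablesA
import Summits.MatrixMultiplication.MatrixMultiplication.Theorems.AbelianSTPPCensusShapeCertVPTables

/-!
# Abelian STPP census — soundness of `ShapeCertVQ` (part 2: the static data is correct)

Cell mm-stpp, rung F-M1; successor kernel item VQ-CERT in support of the closed crux item stmt-MatrixMultiplication-19191; seat
mm-stpp-vp-p2 (gen 1).  Verbatim after theory g6's `…ShapeCertVPTables` for the regenerated data of `…ShapeCertVQData` /
`…ShapeCertVQCandA/B/C` (universe order `489`, level floor `11`): kernel evaluations (`decide +kernel`, no `native_decide`) over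
the universe of order `489` in slices certify the data (first slices: `…ShapeCertVQTablesA`), and the consequences used by the
search are derived:
* `gainQ_pow_le` — `V⁵·10³⁶ ≤ gainQ(V)⁶` for `V ≤ 512` (so `V^{5/6} ≤ gainQ(V)/10⁶`);
* `rhoTQ_le_tabRQ` / `qhTQ_le_tabGQ` — for a universe shape `x` of any order `M ≤ 489` with ratio level `≤ L`, the tables at
  level `L` dominate its packing ratio (in every admitting volume bucket) and its six Grynkiewicz ratios;
* `shQ_mem_candQ` — EVERY universe shape of order `M ≤ 489` is a candidate of `candQ M` (all levels are listed);
  `candQ_wf`, `candQ_inUniv`, `candQ_sorted` — the candidates are well-formed records inside the universe, in non-increasing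
  level order; `loLev_lt_levTQ` — every universe shape has level above the floor.
-/

set_option linter.dupNamespace false -- `MatrixMultiplication.MatrixMultiplication` (summit = problem, D-0017)
set_option autoImplicit false

namespace Summit.MatrixMultiplication.MatrixMultiplication.Theorems.ShapeCertVQ

open ShapeCert ShapeCertVP

section kernel_checks
/-! ### Kernel evaluations (part 2; part 1 = `…ShapeCertVQTablesA`) -/

/-- data checks, universe slice `6 ≤ a ≤ 8` -/
theorem allOKQ_s4 : ((univ0Q 489 5 3).all allOKQ) = true := by decide +kernel
/-- data checks, universe slice `9 ≤ a ≤ 14` -/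
theorem allOKQ_s5 : ((univ0Q 489 8 6).all allOKQ) = true := by decide +kernel
/-- data checks, universe slice `15 ≤ a ≤ 24` -/
theorem allOKQ_s6 : ((univ0Q 489 14 10).all allOKQ) = true := by decide +kernel
/-- data checks, universe slice `25 ≤ a ≤ 489` -/
theorem allOKQ_s7 : ((univ0Q 489 24 465).all allOKQ) = true := by decide +kernel

/-- the ratio table is non-decreasing in the level (checked range) -/
theorem tabRQ_step_dec : ∀ L < 60, ∀ k < 8, (tabRQ L).get k ≤ (tabRQ (L + 1)).get k := by decide +kernel
/-- the Grynkiewicz table is non-decreasing in the level (checked range) -/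
theorem tabGQ_step_dec : ∀ L < 60, ∀ i < 6, (tabGQ L).get i ≤ (tabGQ (L + 1)).get i := by decide +kernel
/-- every tabled triple sits at its own ratio level -/
theorem litLevQ_lev : ∀ L < 64, ∀ x ∈ litLevQ L, levTQ x = L := by decide +kernel
/-- the candidate triples come in non-increasing ratio level -/
theorem candTriplesQ_chain : (candTriplesQ.map levTQ).IsChain (fun a b => b ≤ a) := by decide +kernel

end kernel_checks

section tables
/-! ### Monotonicity of the tables -/

/-- high levels read the top row -/
theorem tabRQ_high {L : ℕ} (h : 59 ≤ L) : tabRQ L = tabRQ 59 := by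
  unfold tabRQ
  rw [if_neg (by omega), if_neg (by omega), if_neg (by omega), if_neg (by omega), if_neg (by omega), if_neg (by omega),
    List.getD_eq_default _ _ (by simp [tabRQL5]; omega), List.getD_eq_default _ _ (by simp [tabRQL5])]

/-- high levels read the top row -/
theorem tabGQ_high {L : ℕ} (h : 59 ≤ L) : tabGQ L = tabGQ 59 := by
  unfold tabGQ
  rw [if_neg (by omega), if_neg (by omega), if_neg (by omega), if_neg (by omega), if_neg (by omega), if_neg (by omega),
    List.getD_eq_default _ _ (by simp [tabGQL5]; omega), List.getD_eq_default _ _ (by simp [tabGQL5])]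

/-- one level step of the ratio table -/
theorem tabRQ_step (L k : ℕ) : (tabRQ L).get k ≤ (tabRQ (L + 1)).get k := by
  have hk : (tabRQ L).get k = (tabRQ L).get (min k 7) ∧ (tabRQ (L + 1)).get k = (tabRQ (L + 1)).get (min k 7) := by
    rcases Nat.lt_or_ge k 7 with h | h
    · rw [min_eq_left h.le]; exact ⟨rfl, rfl⟩
    · rw [min_eq_right h]; obtain ⟨j, rfl⟩ := Nat.exists_eq_add_of_le h; rw [Nat.add_comm]; exact ⟨rfl, rfl⟩
  rw [hk.1, hk.2]
  rcases Nat.lt_or_ge L 60 with hL | hL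
  · exact tabRQ_step_dec L hL _ (by omega)
  · rw [tabRQ_high (by omega : 59 ≤ L), tabRQ_high (by omega : 59 ≤ L + 1)]

/-- one level step of the Grynkiewicz table -/
theorem tabGQ_step (L i : ℕ) : (tabGQ L).get i ≤ (tabGQ (L + 1)).get i := by
  have hi : (tabGQ L).get i = (tabGQ L).get (min i 5) ∧ (tabGQ (L + 1)).get i = (tabGQ (L + 1)).get (min i 5) := by
    rcases Nat.lt_or_ge i 5 with h | h
    · rw [min_eq_left h.le]; exact ⟨rfl, rfl⟩
    · rw [min_eq_right h]; obtain ⟨j, rfl⟩ := Nat.exists_eq_add_of_le h; rw [Nat.add_comm]; exact ⟨rfl, rfl⟩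
  rw [hi.1, hi.2]
  rcases Nat.lt_or_ge L 60 with hL | hL
  · exact tabGQ_step_dec L hL _ (by omega)
  · rw [tabGQ_high (by omega : 59 ≤ L), tabGQ_high (by omega : 59 ≤ L + 1)]

/-- **the ratio table is non-decreasing in the level** -/
theorem tabRQ_mono {L L' : ℕ} (h : L ≤ L') (k : ℕ) : (tabRQ L).get k ≤ (tabRQ L').get k := by
  induction h with
  | refl => exact le_rfl
  | step _ ih => exact ih.trans (tabRQ_step _ k)

/-- **the Grynkiewicz table is non-decreasing in the level** -/
theorem tabGQ_mono {L L' : ℕ} (h : L ≤ L') (i : ℕ) : (tabGQ L).get i ≤ (tabGQ L').get i := by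
  induction h with
  | refl => exact le_rfl
  | step _ ih => exact ih.trans (tabGQ_step _ i)

end tables

section universe_slices
/-! ### The universe slices: well-formed, inside `InUniv`, complete -/

variable {M : ℕ}

/-- members of a slice are well formed and inside `InUniv` -/
theorem mem_univ0Q {lo n : ℕ} {t : Sh} (ht : t ∈ univ0Q M lo n) : t = shQ M t.tr ∧ InUniv M t.tr := by
  unfold univ0Q at ht
  simp only [List.mem_flatMap, List.mem_filterMap, List.mem_range, List.mem_range'_1, Sh.force_eq,
    Option.ite_none_right_eq_some, Option.some.injEq] at ht
  obtain ⟨a', -, b', -, c', -, hin, rfl⟩ := ht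
  exact ⟨rfl, hin⟩

/-- **completeness of a slice** (after `ShapeCert.shOf_mem_univ0`) -/
theorem shQ_mem_univ0Q {lo n : ℕ} {x : ℕ × ℕ × ℕ} (hx : InUniv M x) (h1 : lo ≤ x.1 - 1) (h2 : x.1 - 1 < lo + n) :
    shQ M x ∈ univ0Q M lo n := by
  obtain ⟨ha, hb, hc⟩ := hx.pos
  have hv := hx.vol_le
  have hab : x.2.1 * x.1 ≤ M := by
    have h1 := hx.pab_le_vol; unfold pab vol at *
    have : x.1 * x.2.1 * x.2.2 ≤ M := le_trans (Nat.le_add_right _ _) hv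
    nlinarith
  have habc : x.2.2 * (x.1 * x.2.1) ≤ M := by
    unfold vol at hv
    have e : x.2.2 * (x.1 * x.2.1) = x.1 * x.2.1 * x.2.2 := by ring
    have := Nat.le_add_right (x.1 * x.2.1 * x.2.2) (max x.1 (max x.2.1 x.2.2))
    rw [e]; exact this.trans hv
  unfold univ0Q
  simp only [List.mem_flatMap, List.mem_filterMap, List.mem_range, List.mem_range'_1, Sh.force_eq,
    Option.ite_none_right_eq_some, Option.some.injEq]
  refine ⟨x.1 - 1, ⟨h1, by omega⟩, x.2.1 - 1, ?_, x.2.2 - 1, ?_, ?_, ?_⟩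
  · rw [Nat.sub_add_cancel ha]
    exact Nat.lt_of_lt_of_le (Nat.sub_lt hb one_pos) ((Nat.le_div_iff_mul_le ha).mpr hab)
  · rw [Nat.sub_add_cancel ha, Nat.sub_add_cancel hb]
    exact Nat.lt_of_lt_of_le (Nat.sub_lt hc one_pos) ((Nat.le_div_iff_mul_le (Nat.mul_pos ha hb)).mpr habc)
  · rw [Nat.sub_add_cancel ha, Nat.sub_add_cancel hb, Nat.sub_add_cancel hc]; exact hx
  · rw [Nat.sub_add_cancel ha, Nat.sub_add_cancel hb, Nat.sub_add_cancel hc]; rfl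

/-- **the data checks hold for every universe shape of order 489** (the eight slices cover `1 ≤ a ≤ 489`) -/
theorem allOKQ_of_inUniv {x : ℕ × ℕ × ℕ} (hx : InUniv 489 x) : allOKQ (shQ 489 x) = true := by
  have ha := hx.a_le
  obtain ⟨ha1, -, -⟩ := hx.pos
  have pick : ∀ {lo n : ℕ}, ((univ0Q 489 lo n).all allOKQ) = true → lo ≤ x.1 - 1 → x.1 - 1 < lo + n →
      allOKQ (shQ 489 x) = true :=
    fun h h1 h2 => List.all_eq_true.mp h _ (shQ_mem_univ0Q hx h1 h2)
  rcases Nat.lt_or_ge (x.1 - 1) 1 with h | h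
  · exact pick allOKQ_s0 (Nat.zero_le _) (by omega)
  rcases Nat.lt_or_ge (x.1 - 1) 2 with h' | h'
  · exact pick allOKQ_s1 h (by omega)
  rcases Nat.lt_or_ge (x.1 - 1) 3 with h'' | h''
  · exact pick allOKQ_s2 h' (by omega)
  rcases Nat.lt_or_ge (x.1 - 1) 5 with h3 | h3
  · exact pick allOKQ_s3 h'' (by omega)
  rcases Nat.lt_or_ge (x.1 - 1) 8 with h4 | h4
  · exact pick allOKQ_s4 h3 (by omega)
  rcases Nat.lt_or_ge (x.1 - 1) 14 with h5 | h5
  · exact pick allOKQ_s5 h4 (by omega)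
  rcases Nat.lt_or_ge (x.1 - 1) 24 with h6 | h6
  · exact pick allOKQ_s6 h5 (by omega)
  · exact pick allOKQ_s7 h6 (by omega)

end universe_slices

section consequences
/-! ### What the search uses -/

variable {M : ℕ} {x : ℕ × ℕ × ℕ}

/-- **the ratio table dominates**: a universe shape of order `M ≤ 489` with level `≤ L` has `rho ≤ tabRQ L k` in every
volume bucket `k` admitting it -/
theorem rhoTQ_le_tabRQ (hM : M ≤ 489) (hx : InUniv M x) {L : ℕ} (hL : levTQ x ≤ L) {k : ℕ}
    (hk : capOK k (vol x) = true) : rhoTQ x ≤ (tabRQ L).get k := by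
  have h := allOKQ_of_inUniv (inUniv_mono hx hM)
  unfold allOKQ tabOKQ at h
  simp only [Bool.and_eq_true, List.all_eq_true, List.mem_range, Bool.or_eq_true, Bool.not_eq_true',
    decide_eq_true_eq, shQ_V, shQ_rho, shQ_lev] at h
  have hk7 : capOK (min k 7) (vol x) = true := by rwa [capOK_min7]
  have h1 : rhoTQ x ≤ (tabRQ (levTQ x)).get (min k 7) := by
    rcases h.1.1 (min k 7) (by omega) with h' | h'
    · rw [h'] at hk7; exact absurd hk7 (by decide)
    · exact h'
  have h2 : (tabRQ L).get k = (tabRQ L).get (min k 7) := by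
    rcases Nat.lt_or_ge k 7 with h | h
    · rw [min_eq_left h.le]
    · rw [min_eq_right h, B8.get_ge7 _ h, B8.get_ge7 _ (le_refl 7)]
  rw [h2]; exact h1.trans (tabRQ_mono hL _)

/-- **the Grynkiewicz table dominates**: a universe shape of order `M ≤ 489` with level `≤ L` has `qh_t ≤ tabGQ L i`
for each of the six parameters `t = tOf i` -/
theorem qhTQ_le_tabGQ (hM : M ≤ 489) (hx : InUniv M x) {L : ℕ} (hL : levTQ x ≤ L) (i : ℕ) :
    qhTQ x (tOf i) ≤ (tabGQ L).get i := by
  have h := allOKQ_of_inUniv (inUniv_mono hx hM)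
  unfold allOKQ tabOKQ at h
  simp only [Bool.and_eq_true, List.all_eq_true, List.mem_range, decide_eq_true_eq, qh_shQ, shQ_lev] at h
  have hi : tOf i = tOf (min i 5) ∧ (tabGQ L).get i = (tabGQ L).get (min i 5) := by
    rcases Nat.lt_or_ge i 5 with h | h
    · rw [min_eq_left h.le]; exact ⟨rfl, rfl⟩
    · rw [min_eq_right h]
      obtain ⟨j, rfl⟩ := Nat.exists_eq_add_of_le h
      rw [Nat.add_comm]; exact ⟨rfl, rfl⟩
  rw [hi.1, hi.2]
  exact (h.1.2 (min i 5) (by omega)).trans (tabGQ_mono hL _)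

/-- a tabled triple lies in `candTriplesQ` -/
theorem mem_candTriplesQ {L : ℕ} (hL : 12 ≤ L) (hL' : L ≤ 58) (h : x ∈ litLevQ L) : x ∈ candTriplesQ := by
  unfold candTriplesQ
  simp only [List.mem_append]
  interval_cases L <;> simp [h]

/-- ratio levels are below `64` -/
theorem levTQ_lt (x : ℕ × ℕ × ℕ) : levTQ x < 64 := Nat.lt_succ_of_le (min_le_left _ _)

/-- **every universe shape has ratio level above the floor** (and below `hiLev`) -/
theorem loLev_lt_levTQ (hM : M ≤ 489) (hx : InUniv M x) : loLev < levTQ x ∧ levTQ x < hiLev := by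
  have h := allOKQ_of_inUniv (inUniv_mono hx hM)
  unfold allOKQ litOKQ at h
  simp only [Bool.and_eq_true, decide_eq_true_eq, shQ_lev, shQ_tr] at h
  exact ⟨h.2.1.1, h.2.1.2⟩

/-- **completeness of the candidate list**: every universe shape of order `M ≤ 489` is listed -/
theorem shQ_mem_candQ (hM : M ≤ 489) (hx : InUniv M x) : shQ M x ∈ candQ M := by
  have h := allOKQ_of_inUniv (inUniv_mono hx hM)
  unfold allOKQ litOKQ at h
  simp only [Bool.and_eq_true, decide_eq_true_eq, shQ_lev, shQ_tr] at h
  obtain ⟨⟨hlo, hhi⟩, h'⟩ := h.2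
  have hc := mem_candTriplesQ (by unfold loLev at hlo; omega) (by unfold hiLev at hhi; omega) h'
  unfold candQ
  rw [List.mem_filterMap]
  refine ⟨x, hc, ?_⟩
  have hin : inUnivB M x.1 x.2.1 x.2.2 = true := hx
  rw [if_pos hin, Sh.force_eq]; rfl

/-- members of the candidate list come from tabled universe triples -/
theorem mem_candQ {t : Sh} (ht : t ∈ candQ M) : ∃ x ∈ candTriplesQ, InUniv M x ∧ t = shQ M x := by
  unfold candQ at ht
  rw [List.mem_filterMap] at ht
  obtain ⟨x, hx, h⟩ := ht
  by_cases hin : inUnivB M x.1 x.2.1 x.2.2 = true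
  · rw [if_pos hin, Sh.force_eq, Option.some.injEq] at h
    exact ⟨x, hx, hin, by rw [← h]; rfl⟩
  · rw [if_neg hin] at h; exact absurd h (by simp)

/-- the candidate list is well formed -/
theorem candQ_wf (M : ℕ) : WfQ M (candQ M) := by
  intro t ht; obtain ⟨x, -, -, rfl⟩ := mem_candQ ht; rw [shQ_tr]

/-- the candidate list lies inside the universe -/
theorem candQ_inUniv (M : ℕ) : ∀ t ∈ candQ M, InUniv M t.tr := by
  intro t ht; obtain ⟨x, -, hx, rfl⟩ := mem_candQ ht; rwa [shQ_tr]

/-- **the candidate list is in non-increasing ratio level** -/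
theorem candQ_sorted (M : ℕ) : (candQ M).Pairwise (fun s t => t.lev ≤ s.lev) := by
  haveI : IsTrans ℕ (fun a b => b ≤ a) := ⟨fun _ _ _ h1 h2 => h2.trans h1⟩
  have hp : (candTriplesQ.map levTQ).Pairwise (fun a b => b ≤ a) :=
    List.isChain_iff_pairwise.mp candTriplesQ_chain
  rw [List.pairwise_map] at hp
  unfold candQ
  rw [List.pairwise_filterMap]
  refine hp.imp ?_
  intro x y hxy s hs t ht
  have es : s = shQ M x := by
    by_cases hin : inUnivB M x.1 x.2.1 x.2.2 = true
    · rw [if_pos hin, Sh.force_eq, Option.some.injEq] at hs; rw [← hs]; rfl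
    · rw [if_neg hin] at hs; exact absurd hs (by simp)
  have et : t = shQ M y := by
    by_cases hin : inUnivB M y.1 y.2.1 y.2.2 = true
    · rw [if_pos hin, Sh.force_eq, Option.some.injEq] at ht; rw [← ht]; rfl
    · rw [if_neg hin] at ht; exact absurd ht (by simp)
  rw [es, et, shQ_lev, shQ_lev]; exact hxy

end consequences

end Summit.MatrixMultiplication.MatrixMultiplication.Theorems.ShapeCertVQ
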